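import Mathlib
import HarnessLib
import Summits.NavierStokesRegularity.NavierStokesRegularity.Theorems.UnthreadedRigidityDoorUnthreadedRigidityProfileHornDefs

/-!
# Route `UnthreadedRigidityDoor`, wall item W2 `UnthreadedRigidity` (stmt-NavierStokesRegularity-27585) — LINE g12-3 «POLYHEDRAL LIOUVILLE»
# (ns-idea-6 g12, `Polyhedral_sketch.lean` v1.2 ea3234bdf3a4cf19; DIRECTOR-NS #294): support S-IRR `SkewConjIrreducible`, VERBATIM
# (the sketch-local `IsIrreducible` and `conj` unfolded) — a PORT of the author's sorry-free proof `skewConjIrreducible_holds` (v1.2 §7)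

Seat ns-es-p1 g8 (W2 second queue; announce-before-propose on the ideators bus).  The mathematics and the proof are ns-idea-6 g12's (classification-free,
Schur-free axial-vector argument); this file re-homes it under `Theorems/` without sketch-local definitions: the standard basis vectors are
`EuclideanSpace.single i 1`, the axial vector `k(A) = (⟪Ae₁,e₂⟫, −⟪Ae₀,e₂⟫, ⟪Ae₀,e₁⟫)` and its linear-map packaging are local `set`/`let`s of the
main proof.

* `skewConjIrreducible` — **S-IRR VERBATIM**: a nonzero linear subspace `𝔞` of skew operators on `ℝ³`, stable under conjugation `A ↦ g A g⁻¹` by an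
  IRREDUCIBLE set `G` of linear isometries, contains every skew operator.  PROOF (author's): `A k(A) = 0`, `k(A) = 0 ⇒ A = 0`, `ker A = ℝ k(A)` for skew
  `A ≠ 0`; `V := k(𝔞)` is `G`-stable (`g k(A) ∈ ker(gAg⁻¹)`), nonzero, hence `= ℝ³`; then `k(B) = k(A)` with `A ∈ 𝔞` forces `B = A`.

HONEST LABEL: a support of a files-only rung line (model/rung work); nothing here bears on `UnthreadedRigidity` (27585), the door Target, W2 or Navier–Stokes
regularity; no summit statement is proved.
-/

noncomputable section

-- the summit and its single sub-problem share the name (CONVENTIONS §1), as in every Theorems file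
set_option linter.dupNamespace false

namespace Summit.NavierStokesRegularity.NavierStokesRegularity.Theorems.UnthreadedRigidity.Polyhedral

open Summit.NavierStokesRegularity.NavierStokesRegularity.Theorems.UnthreadedRigidity.ProfileHorn (E3)

/-! ## Coordinates on `E3` -/

/-- Expansion in the standard basis. -/
theorem repr3 (v : E3) :
    v = v 0 • (EuclideanSpace.single 0 (1 : ℝ) : E3) + v 1 • (EuclideanSpace.single 1 (1 : ℝ) : E3) +
      v 2 • (EuclideanSpace.single 2 (1 : ℝ) : E3) := by
  have h := ((EuclideanSpace.basisFun (Fin 3) ℝ).sum_repr' v).symm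
  rw [Fin.sum_univ_three] at h
  simpa [EuclideanSpace.basisFun_apply, EuclideanSpace.inner_single_left] using h

/-- A vector vanishes iff its three coordinates do. -/
theorem eq_zero_of_coords (v : E3) (h0 : v 0 = 0) (h1 : v 1 = 0) (h2 : v 2 = 0) : v = 0 := by
  rw [repr3 v, h0, h1, h2]; simp

variable {A : E3 →L[ℝ] E3}

/-- Polarisation of skewness: `⟪Au, v⟫ = −⟪Av, u⟫`. -/
theorem skew_polar (hA : ∀ x, inner ℝ (A x) x = 0) (u v : E3) : inner ℝ (A u) v = - inner ℝ (A v) u := by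
  have h := hA (u + v)
  rw [map_add, inner_add_left, inner_add_right, inner_add_right, hA u, hA v] at h
  rw [real_inner_comm u] at h
  linarith [real_inner_comm (A v) u, real_inner_comm (A u) v]

/-- Coordinates of `A v` through the three entries `p = ⟪Ae₀,e₁⟫, q = ⟪Ae₀,e₂⟫, r = ⟪Ae₁,e₂⟫` of a skew operator. -/
theorem skew_apply_coords (hA : ∀ x, inner ℝ (A x) x = 0) (v : E3) :
    (A v) 0 = -(inner ℝ (A (EuclideanSpace.single 0 (1 : ℝ))) (EuclideanSpace.single 1 (1 : ℝ))) * v 1 -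
        (inner ℝ (A (EuclideanSpace.single 0 (1 : ℝ))) (EuclideanSpace.single 2 (1 : ℝ))) * v 2 ∧
    (A v) 1 = (inner ℝ (A (EuclideanSpace.single 0 (1 : ℝ))) (EuclideanSpace.single 1 (1 : ℝ))) * v 0 -
        (inner ℝ (A (EuclideanSpace.single 1 (1 : ℝ))) (EuclideanSpace.single 2 (1 : ℝ))) * v 2 ∧
    (A v) 2 = (inner ℝ (A (EuclideanSpace.single 0 (1 : ℝ))) (EuclideanSpace.single 2 (1 : ℝ))) * v 0 +
        (inner ℝ (A (EuclideanSpace.single 1 (1 : ℝ))) (EuclideanSpace.single 2 (1 : ℝ))) * v 1 := by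
  set e0 : E3 := EuclideanSpace.single 0 (1 : ℝ) with he0
  set e1 : E3 := EuclideanSpace.single 1 (1 : ℝ) with he1
  set e2 : E3 := EuclideanSpace.single 2 (1 : ℝ) with he2
  have hv := repr3 v
  have hAv : A v = v 0 • A e0 + v 1 • A e1 + v 2 • A e2 := by
    conv_lhs => rw [hv]
    simp only [map_add, map_smul, he0, he1, he2]
  have hin : ∀ (w : E3) (i : Fin 3), inner ℝ w (EuclideanSpace.single i (1 : ℝ)) = w i := fun w i => by
    simp [EuclideanSpace.inner_single_right]
  have d0 : (A e0) 0 = 0 := by have := hA e0; rw [he0, hin] at this; exact this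
  have d1 : (A e1) 1 = 0 := by have := hA e1; rw [he1, hin] at this; exact this
  have d2 : (A e2) 2 = 0 := by have := hA e2; rw [he2, hin] at this; exact this
  have s10 : (A e1) 0 = -(inner ℝ (A e0) e1) := by
    have := skew_polar hA e1 e0; rw [he0, hin] at this; rw [← he0] at this; exact this
  have s20 : (A e2) 0 = -(inner ℝ (A e0) e2) := by
    have := skew_polar hA e2 e0; rw [he0, hin] at this; rw [← he0] at this; exact this
  have s21 : (A e2) 1 = -(inner ℝ (A e1) e2) := by
    have := skew_polar hA e2 e1; rw [he1, hin] at this; rw [← he1] at this; exact this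
  have s01 : (A e0) 1 = inner ℝ (A e0) e1 := by rw [he1, hin]
  have s02 : (A e0) 2 = inner ℝ (A e0) e2 := by rw [he2, hin]
  have s12 : (A e1) 2 = inner ℝ (A e1) e2 := by rw [he2, hin]
  refine ⟨?_, ?_, ?_⟩
  · have := congrArg (fun w : E3 => w 0) hAv
    simp only [PiLp.add_apply, PiLp.smul_apply, smul_eq_mul] at this
    rw [this, d0, s10, s20]; ring
  · have := congrArg (fun w : E3 => w 1) hAv
    simp only [PiLp.add_apply, PiLp.smul_apply, smul_eq_mul] at this
    rw [this, d1, s01, s21]; ring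
  · have := congrArg (fun w : E3 => w 2) hAv
    simp only [PiLp.add_apply, PiLp.smul_apply, smul_eq_mul] at this
    rw [this, d2, s02, s12]; ring

/-! ## S-IRR -/

/-- **S-IRR `SkewConjIrreducible` (VERBATIM, `IsIrreducible`/`conj` unfolded)** — module docstring; author ns-idea-6 g12. -/
theorem skewConjIrreducible :
    ∀ (G : Set (E3 ≃ₗᵢ[ℝ] E3)) (𝔞 : Submodule ℝ (E3 →L[ℝ] E3)),
      (∀ V : Submodule ℝ E3, (∀ g ∈ G, ∀ v ∈ V, g v ∈ V) → V = ⊥ ∨ V = ⊤) →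
      (∀ A ∈ 𝔞, ∀ x, inner ℝ (A x) x = 0) → 𝔞 ≠ ⊥ →
      (∀ g ∈ G, ∀ A ∈ 𝔞,
        ((g.toContinuousLinearEquiv : E3 →L[ℝ] E3).comp A).comp (g.symm.toContinuousLinearEquiv : E3 →L[ℝ] E3) ∈ 𝔞) →
      ∀ A : E3 →L[ℝ] E3, (∀ x, inner ℝ (A x) x = 0) → A ∈ 𝔞 := by
  intro G 𝔞 hG hskew hne hstab B hB
  set e0 : E3 := EuclideanSpace.single 0 (1 : ℝ) with he0
  set e1 : E3 := EuclideanSpace.single 1 (1 : ℝ) with he1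
  set e2 : E3 := EuclideanSpace.single 2 (1 : ℝ) with he2
  have hin : ∀ (w : E3) (i : Fin 3), inner ℝ w (EuclideanSpace.single i (1 : ℝ)) = w i := fun w i => by
    simp [EuclideanSpace.inner_single_right]
  have he0c : ∀ i : Fin 3, e0 i = if i = 0 then 1 else 0 := fun i => by simp [he0]
  have he1c : ∀ i : Fin 3, e1 i = if i = 1 then 1 else 0 := fun i => by simp [he1]
  have he2c : ∀ i : Fin 3, e2 i = if i = 2 then 1 else 0 := fun i => by simp [he2]
  -- the axial vector
  set ax : (E3 →L[ℝ] E3) → E3 := fun A =>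
    (inner ℝ (A e1) e2) • e0 + (-(inner ℝ (A e0) e2)) • e1 + (inner ℝ (A e0) e1) • e2 with hax
  have hax0 : ∀ A : E3 →L[ℝ] E3, ax A 0 = inner ℝ (A e1) e2 := fun A => by
    simp [hax, he0c, he1c, he2c]
  have hax1 : ∀ A : E3 →L[ℝ] E3, ax A 1 = -(inner ℝ (A e0) e2) := fun A => by
    simp [hax, he0c, he1c, he2c]
  have hax2 : ∀ A : E3 →L[ℝ] E3, ax A 2 = inner ℝ (A e0) e1 := fun A => by
    simp [hax, he0c, he1c, he2c]
  -- `A` kills its axial vector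
  have apply_axial : ∀ A : E3 →L[ℝ] E3, (∀ x, inner ℝ (A x) x = 0) → A (ax A) = 0 := by
    intro A hA
    obtain ⟨h0, h1, h2⟩ := skew_apply_coords hA (ax A)
    apply eq_zero_of_coords
    · rw [h0, hax1, hax2]; ring
    · rw [h1, hax0, hax2]; ring
    · rw [h2, hax0, hax1]; ring
  -- the axial vector detects `A`
  have eq_zero_of_axial : ∀ A : E3 →L[ℝ] E3, (∀ x, inner ℝ (A x) x = 0) → ax A = 0 → A = 0 := by
    intro A hA hk
    have hp : inner ℝ (A e0) e1 = 0 := by have := congrArg (fun w : E3 => w 2) hk; rwa [hax2] at this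
    have hq : inner ℝ (A e0) e2 = 0 := by
      have := congrArg (fun w : E3 => w 1) hk; rw [hax1] at this; simpa using this
    have hr : inner ℝ (A e1) e2 = 0 := by have := congrArg (fun w : E3 => w 0) hk; rwa [hax0] at this
    ext v i
    obtain ⟨h0, h1, h2⟩ := skew_apply_coords hA v
    rw [← he0, ← he1, ← he2] at h0 h1 h2
    fin_cases i
    · simpa [hp, hq] using h0
    · simpa [hp, hr] using h1
    · simpa [hq, hr] using h2
  -- KERNEL LINE: a nonzero skew operator kills only the multiples of its axial vector
  have mem_span_axial : ∀ A : E3 →L[ℝ] E3, (∀ x, inner ℝ (A x) x = 0) → A ≠ 0 → ∀ v : E3, A v = 0 →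
      ∃ μ : ℝ, v = μ • ax A := by
    intro A hA hA0 v hv
    obtain ⟨h0, h1, h2⟩ := skew_apply_coords hA v
    rw [← he0, ← he1, ← he2] at h0 h1 h2
    rw [hv] at h0 h1 h2
    simp only [PiLp.zero_apply] at h0 h1 h2
    have hk : ax A ≠ 0 := fun h => hA0 (eq_zero_of_axial A hA h)
    have hn : inner ℝ (A e1) e2 ^ 2 + inner ℝ (A e0) e2 ^ 2 + inner ℝ (A e0) e1 ^ 2 ≠ 0 := by
      intro h
      apply hk
      have hr0 : inner ℝ (A e1) e2 = 0 := by
        nlinarith [sq_nonneg (inner ℝ (A e1) e2), sq_nonneg (inner ℝ (A e0) e2), sq_nonneg (inner ℝ (A e0) e1)]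
      have hq0 : inner ℝ (A e0) e2 = 0 := by
        nlinarith [sq_nonneg (inner ℝ (A e1) e2), sq_nonneg (inner ℝ (A e0) e2), sq_nonneg (inner ℝ (A e0) e1)]
      have hp0 : inner ℝ (A e0) e1 = 0 := by
        nlinarith [sq_nonneg (inner ℝ (A e1) e2), sq_nonneg (inner ℝ (A e0) e2), sq_nonneg (inner ℝ (A e0) e1)]
      apply eq_zero_of_coords
      · rw [hax0, hr0]
      · rw [hax1, hq0, neg_zero]
      · rw [hax2, hp0]
    refine ⟨(v 0 * inner ℝ (A e1) e2 - v 1 * inner ℝ (A e0) e2 + v 2 * inner ℝ (A e0) e1) /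
      (inner ℝ (A e1) e2 ^ 2 + inner ℝ (A e0) e2 ^ 2 + inner ℝ (A e0) e1 ^ 2), ?_⟩
    rw [← sub_eq_zero]
    apply eq_zero_of_coords
    · simp only [PiLp.sub_apply, PiLp.smul_apply, smul_eq_mul, hax0]
      field_simp
      linear_combination (-(inner ℝ (A e0) e2)) * h2 + (-(inner ℝ (A e0) e1)) * h1
    · simp only [PiLp.sub_apply, PiLp.smul_apply, smul_eq_mul, hax1]
      field_simp
      linear_combination (-(inner ℝ (A e1) e2)) * h2 + (inner ℝ (A e0) e1) * h0
    · simp only [PiLp.sub_apply, PiLp.smul_apply, smul_eq_mul, hax2]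
      field_simp
      linear_combination (inner ℝ (A e1) e2) * h1 + (inner ℝ (A e0) e2) * h0
  -- the axial vector is linear in `A`
  let axL : (E3 →L[ℝ] E3) →ₗ[ℝ] E3 :=
    { toFun := ax
      map_add' := fun A A' => by
        apply eq_zero_of_coords _ ?_ ?_ ?_ |> fun h => (sub_eq_zero.mp h)
        · simp only [PiLp.sub_apply, PiLp.add_apply, hax0, _root_.add_apply, inner_add_left]; ring
        · simp only [PiLp.sub_apply, PiLp.add_apply, hax1, _root_.add_apply, inner_add_left]; ring
        · simp only [PiLp.sub_apply, PiLp.add_apply, hax2, _root_.add_apply, inner_add_left]; ring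
      map_smul' := fun c A => by
        apply eq_zero_of_coords _ ?_ ?_ ?_ |> fun h => (sub_eq_zero.mp h)
        · simp only [PiLp.sub_apply, PiLp.smul_apply, hax0, _root_.smul_apply,
            inner_smul_left, smul_eq_mul, RingHom.id_apply, conj_trivial]; ring
        · simp only [PiLp.sub_apply, PiLp.smul_apply, hax1, _root_.smul_apply,
            inner_smul_left, smul_eq_mul, RingHom.id_apply, conj_trivial]; ring
        · simp only [PiLp.sub_apply, PiLp.smul_apply, hax2, _root_.smul_apply,
            inner_smul_left, smul_eq_mul, RingHom.id_apply, conj_trivial]; ring }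
  have haxL : ∀ A : E3 →L[ℝ] E3, axL A = ax A := fun A => rfl
  -- conjugation bookkeeping
  have conj_apply_map : ∀ (g : E3 ≃ₗᵢ[ℝ] E3) (A : E3 →L[ℝ] E3) (v : E3),
      (((g.toContinuousLinearEquiv : E3 →L[ℝ] E3).comp A).comp (g.symm.toContinuousLinearEquiv : E3 →L[ℝ] E3)) (g v) = g (A v) := by
    intro g A v
    simp
  have eq_zero_of_conj_eq_zero : ∀ (g : E3 ≃ₗᵢ[ℝ] E3) (A : E3 →L[ℝ] E3),
      ((g.toContinuousLinearEquiv : E3 →L[ℝ] E3).comp A).comp (g.symm.toContinuousLinearEquiv : E3 →L[ℝ] E3) = 0 → A = 0 := by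
    intro g A h
    ext w i
    have := congrArg (fun T : E3 →L[ℝ] E3 => g.symm (T (g w))) h
    simp only [conj_apply_map, LinearIsometryEquiv.symm_apply_apply, _root_.zero_apply, map_zero] at this
    rw [this]; rfl
  -- the `G`-stable subspace `V = k(𝔞)`
  let V : Submodule ℝ E3 := 𝔞.map axL
  have hV : ∀ g ∈ G, ∀ v ∈ V, g v ∈ V := by
    intro g hg v hv
    obtain ⟨A, hA𝔞, rfl⟩ := Submodule.mem_map.mp hv
    rw [haxL]
    by_cases hA0 : A = 0
    · subst hA0
      have hz : ax 0 = 0 := by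
        apply eq_zero_of_coords
        · rw [hax0]; simp
        · rw [hax1]; simp
        · rw [hax2]; simp
      rw [hz, map_zero]
      exact V.zero_mem
    · set A' : E3 →L[ℝ] E3 :=
        ((g.toContinuousLinearEquiv : E3 →L[ℝ] E3).comp A).comp (g.symm.toContinuousLinearEquiv : E3 →L[ℝ] E3) with hA'
      have hB' : A' ∈ 𝔞 := hstab g hg A hA𝔞
      have hB'skew : ∀ x, inner ℝ (A' x) x = 0 := hskew _ hB'
      have hB'0 : A' ≠ 0 := fun h => hA0 (eq_zero_of_conj_eq_zero g A h)
      have hkill : A' (g (ax A)) = 0 := by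
        rw [hA', conj_apply_map, apply_axial A (hskew A hA𝔞), map_zero]
      obtain ⟨μ, hμ⟩ := mem_span_axial A' hB'skew hB'0 _ hkill
      rw [hμ]
      exact V.smul_mem μ (Submodule.mem_map.mpr ⟨A', hB', rfl⟩)
  have hVne : V ≠ ⊥ := by
    obtain ⟨A₀, hA₀, hA₀0⟩ := Submodule.exists_mem_ne_zero_of_ne_bot hne
    intro hbot
    have hmem : ax A₀ ∈ V := Submodule.mem_map.mpr ⟨A₀, hA₀, rfl⟩
    rw [hbot, Submodule.mem_bot] at hmem
    exact hA₀0 (eq_zero_of_axial A₀ (hskew A₀ hA₀) hmem)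
  have hVtop : V = ⊤ := (hG V hV).resolve_left hVne
  have hBmem : ax B ∈ V := by rw [hVtop]; exact Submodule.mem_top
  obtain ⟨A, hA𝔞, hAB⟩ := Submodule.mem_map.mp hBmem
  rw [haxL] at hAB
  have hskAB : ∀ x, inner ℝ ((A - B) x) x = 0 := by
    intro x; simp [inner_sub_left, hskew A hA𝔞 x, hB x]
  have hax_sub : ax (A - B) = ax A - ax B := by
    have h := axL.map_sub A B
    simpa only [haxL] using h
  have hzero : A - B = 0 := eq_zero_of_axial (A - B) hskAB (by rw [hax_sub]; exact sub_eq_zero.mpr hAB)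
  have hBA : B = A := (sub_eq_zero.mp hzero).symm
  rw [hBA]; exact hA𝔞

end Summit.NavierStokesRegularity.NavierStokesRegularity.Theorems.UnthreadedRigidity.Polyhedral

end
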